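import Literature.Probability.RandomPlanarGeometry.HullDecomposition
import Literature.Probability.RandomPlanarGeometry.HullApproximation
import HarnessLib

/-!
# A clopen piece of a `*`-hull is a `*`-hull

Topic `Probability/RandomPlanarGeometry`; theorems only. For a `*`-hull `A ∈ 𝒬*`
(`IsStarHull`: bounded, `A = cl(A ∩ ℍ)`, `ℍ ∖ A` simply connected, `0 ∉ A`) and a subset
`S ⊆ A` which is relatively clopen in `A` (both `S` and `A ∖ S` closed), `S` is again a `*`-hull
(`IsStarHull.isStarHull_piece`). This is the topological input for following the hull of an
SLE₆ through the swallowing of whole clusters of `A` (locality of SLE₆, Lawler–Schramm–Werner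
(2001) Thm. 2.2 / Lawler (2005) Thm. 6.13: the part of `A` not yet swallowed is a clopen piece of
`A`), and generalises the `±`-decomposition of `HullDecomposition` (`sidePart`), whose proofs are
repeated here for an abstract piece:

* `IsStarHull.connectedComponentIn_subset_piece` — components of `A` through points of `S` stay in `S`;
* `IsStarHull.closure_piece_inter` — `S = cl(S ∩ ℍ)`;
* `IsStarHull.isConnected_piece_union_im_nonpos` — `S ∪ {Im ≤ 0}` is connected (every component
  of `A` meets `ℝ`, `IsStarHull.exists_real_mem_connectedComponentIn` with
  `IsBoundedHull.isConnected_union_im_nonpos`);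
* `IsStarHull.isConnected_diff_piece` — `ℍ ∖ S` is connected (a component missing `ℍ ∖ A` would be
  a bounded open subset of `A ∖ S` with a topmost point on a vertical line in `ℍ ∩ (A ∖ S)`);
* `IsStarHull.isSimplyConnected_diff_piece`, `IsStarHull.isStarHull_piece`.

## References

* G. F. Lawler, O. Schramm, W. Werner, *Conformal restriction: the chordal case*, JAMS 16 (2003),
  §2 p. 8 (hulls `𝒬*`, `A = A₁ · A₂`). [LawlerSchrammWerner2003Restriction]
* G. F. Lawler, *Conformally Invariant Processes in the Plane* (2005), §6.3 Thm. 6.13. [Lawler2005]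
-/

noncomputable section

open Set Filter Topology Metric Bornology Complex
open UpperHalfPlane (upperHalfPlaneSet isOpen_upperHalfPlaneSet)

namespace Literature.Probability.RandomPlanarGeometry

namespace IsStarHull

variable {A S : Set ℂ} (hA : IsStarHull A) (hSA : S ⊆ A) (hS : IsClosed S) (hS' : IsClosed (A \ S))

omit hA in
include hSA hS hS' in
/-- **Components of `A` through points of a clopen piece stay in the piece.** [folklore] -/
theorem connectedComponentIn_subset_piece {a : ℂ} (ha : a ∈ S) :
    connectedComponentIn A a ⊆ S := by
  have hpre : IsPreconnected (connectedComponentIn A a) := isPreconnected_connectedComponentIn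
  have hsub : connectedComponentIn A a ⊆ A := connectedComponentIn_subset A a
  rw [isPreconnected_iff_subset_of_disjoint_closed] at hpre
  have hcover : connectedComponentIn A a ⊆ S ∪ A \ S := fun z hz ↦ by
    by_cases hzS : z ∈ S
    · exact Or.inl hzS
    · exact Or.inr ⟨hsub hz, hzS⟩
  have hdisj : connectedComponentIn A a ∩ (S ∩ (A \ S)) = ∅ := by
    rw [← subset_empty_iff]
    rintro z ⟨-, hzS, -, hzS'⟩
    exact hzS' hzS
  rcases hpre S (A \ S) hS hS' hcover hdisj with h | h
  · exact h
  · exact absurd ha (h (mem_connectedComponentIn (hSA ha))).2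

include hA hSA hS hS' in
/-- **A clopen piece is the closure of its part in `ℍ`**: `S = cl(S ∩ ℍ)`. [folklore] -/
theorem closure_piece_inter : closure (S ∩ upperHalfPlaneSet) = S := by
  refine Subset.antisymm (closure_minimal inter_subset_left hS) fun a ha ↦ ?_
  have hO : IsOpen (A \ S)ᶜ := hS'.isOpen_compl
  have haO : a ∈ (A \ S)ᶜ := fun h ↦ h.2 ha
  have hacl : a ∈ closure (A ∩ upperHalfPlaneSet) := by
    rw [hA.isBoundedHull.closure_inter_eq]; exact hSA ha
  have h1 := hO.inter_closure ⟨haO, hacl⟩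
  refine closure_mono ?_ h1
  rintro z ⟨hzO, hzA, hzH⟩
  refine ⟨?_, hzH⟩
  by_contra hzS
  exact hzO ⟨hzA, hzS⟩

include hA hSA hS hS' in
/-- **`S ∪ {Im ≤ 0}` is connected** for a clopen piece `S` of a `*`-hull: every component of `A`
through a point of `S` lies in `S` and meets the real axis (`A` has no floating pieces). [folklore] -/
theorem isConnected_piece_union_im_nonpos : IsConnected (S ∪ {z : ℂ | z.im ≤ 0}) := by
  set L : Set ℂ := {z : ℂ | z.im ≤ 0} with hL
  have hLc : IsPreconnected L := (convex_halfSpace_im_le 0).isPreconnected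
  refine ⟨⟨0, Or.inr (by simp [hL])⟩, ?_⟩
  rcases S.eq_empty_or_nonempty with he | hne
  · rw [he, empty_union]; exact hLc
  have hnf := hA.isBoundedHull.isConnected_union_im_nonpos
  have heq : S ∪ L = ⋃ a : S, (connectedComponentIn A a ∪ L) := by
    refine Subset.antisymm ?_ (iUnion_subset fun a ↦ union_subset_union_left _
      (connectedComponentIn_subset_piece hSA hS hS' a.2))
    rintro z (hz | hz)
    · exact mem_iUnion.2 ⟨⟨z, hz⟩, Or.inl (mem_connectedComponentIn (hSA hz))⟩
    · obtain ⟨a, ha⟩ := hne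
      exact mem_iUnion.2 ⟨⟨a, ha⟩, Or.inr hz⟩
  rw [heq]
  refine isPreconnected_iUnion ⟨0, mem_iInter.2 fun a ↦ Or.inr (by simp [hL])⟩ fun a ↦ ?_
  obtain ⟨x, -, hxa⟩ := hA.exists_real_mem_connectedComponentIn hnf (hSA a.2)
  exact isPreconnected_connectedComponentIn.union' ⟨x, hxa, by simp [hL]⟩ hLc

include hA hSA hS hS' in
/-- **`ℍ ∖ S` is connected** for a clopen piece `S` of a `*`-hull: it contains the connected
`ℍ ∖ A`, and a component of it missing `ℍ ∖ A` would be a bounded open subset of `A ∖ S`, whose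
topmost point on a vertical line would be a point of `ℍ ∩ (A ∖ S)` in the closure of the
component but outside it. [folklore] -/
theorem isConnected_diff_piece : IsConnected (upperHalfPlaneSet \ S) := by
  set S' := A \ S with hS'def
  set O := upperHalfPlaneSet \ S with hOdef
  have hOo : IsOpen O := isOpen_upperHalfPlaneSet.sdiff hS
  have hU : IsConnected (upperHalfPlaneSet \ A) := hA.1.2.2.isPathConnected.isConnected
  have hUO : upperHalfPlaneSet \ A ⊆ O := fun z hz ↦ ⟨hz.1, fun h ↦ hz.2 (hSA h)⟩
  obtain ⟨u₀, hu₀⟩ := hU.nonempty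
  set W := connectedComponentIn O u₀ with hWdef
  have hUW : upperHalfPlaneSet \ A ⊆ W := hU.isPreconnected.subset_connectedComponentIn hu₀ hUO
  -- bound on `A`
  obtain ⟨M, hM⟩ := hA.isBoundedHull.1.subset_closedBall 0
  have hMA : ∀ w ∈ A, ‖w‖ ≤ M := fun w hw ↦ by
    have := hM hw; rwa [mem_closedBall, dist_zero_right] at this
  refine ⟨⟨u₀, hUO hu₀⟩, ?_⟩
  suffices hOW : O ⊆ W by
    have : O = W := Subset.antisymm hOW (connectedComponentIn_subset _ _)
    rw [this]; exact isPreconnected_connectedComponentIn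
  intro z hz
  by_contra hzW
  set V := connectedComponentIn O z with hVdef
  have hVo : IsOpen V := hOo.connectedComponentIn
  have hzV : z ∈ V := mem_connectedComponentIn hz
  -- `V` misses `ℍ ∖ A`, hence `V ⊆ S'`
  have hVU : ∀ v ∈ V, v ∉ upperHalfPlaneSet \ A := fun v hvV hvU ↦ by
    have h1 : W = connectedComponentIn O v := connectedComponentIn_eq (hUW hvU)
    have h2 : V = connectedComponentIn O v := connectedComponentIn_eq hvV
    exact hzW (by rw [h1, ← h2]; exact hzV)
  have hVS' : V ⊆ S' := fun v hv ↦ by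
    have hvO : v ∈ O := connectedComponentIn_subset _ _ hv
    have hvA : v ∈ A := by
      by_contra hvA
      exact hVU v hv ⟨hvO.1, hvA⟩
    exact ⟨hvA, hvO.2⟩
  -- the vertical ray from `z`
  set f : ℝ → ℂ := fun t ↦ z + t * I with hf
  have hfc : Continuous f := by rw [hf]; fun_prop
  have hfim : ∀ t, (f t).im = z.im + t := fun t ↦ by simp [hf]
  have hfnorm : ∀ t, 0 ≤ t → t - ‖z‖ ≤ ‖f t‖ := fun t ht ↦ by
    have h1 : ‖(t : ℂ) * I‖ = t := by
      rw [norm_mul, norm_real, norm_I, mul_one, Real.norm_of_nonneg ht]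
    have h2 := norm_sub_norm_le ((t : ℂ) * I) (-z)
    rw [h1, norm_neg, sub_neg_eq_add, add_comm] at h2
    exact h2
  set t₁ : ℝ := M + ‖z‖ + 1 with ht₁
  have ht₁0 : 0 ≤ t₁ := by
    have : 0 ≤ M := (norm_nonneg _).trans (hMA _ (hVS' hzV).1)
    rw [ht₁]; positivity
  have hft₁ : f t₁ ∉ V := fun h ↦ by
    have h1 := hMA _ (hVS' h).1
    have h2 := hfnorm t₁ ht₁0
    rw [ht₁] at h2
    linarith
  set D : Set ℝ := {t | t ∈ Icc 0 t₁ ∧ f t ∈ V} with hD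
  have hD0 : (0 : ℝ) ∈ D := ⟨⟨le_rfl, ht₁0⟩, by simpa [hf] using hzV⟩
  have hDbdd : BddAbove D := ⟨t₁, fun t ht ↦ ht.1.2⟩
  set τ := sSup D with hτ
  have hτmem : τ ∈ closure D := csSup_mem_closure ⟨0, hD0⟩ hDbdd
  have hτ0 : 0 ≤ τ := le_csSup hDbdd hD0
  have hτ1 : τ ≤ t₁ := csSup_le ⟨0, hD0⟩ fun t ht ↦ ht.1.2
  -- `f τ ∈ closure V`
  have hfτcl : f τ ∈ closure V := by
    have h1 : f τ ∈ closure (f '' D) :=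
      image_closure_subset_closure_image hfc ⟨τ, hτmem, rfl⟩
    exact closure_mono (by rintro _ ⟨t, ht, rfl⟩; exact ht.2) h1
  -- `f τ ∉ V`
  have hfτV : f τ ∉ V := fun hin ↦ by
    rcases hτ1.lt_or_eq with hlt | heq
    · obtain ⟨δ, hδ, hball⟩ := Metric.isOpen_iff.1 hVo _ hin
      set t' := min t₁ (τ + δ / 2) with ht'
      have ht'τ : τ < t' := lt_min hlt (by linarith)
      have ht'D : t' ∈ D := by
        refine ⟨⟨hτ0.trans ht'τ.le, min_le_left _ _⟩, hball ?_⟩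
        rw [mem_ball, dist_eq_norm]
        have : f t' - f τ = ((t' - τ : ℝ) : ℂ) * I := by simp [hf]; ring
        rw [this, norm_mul, norm_real, norm_I, mul_one, Real.norm_of_nonneg (by linarith)]
        have := min_le_right t₁ (τ + δ / 2)
        linarith
      have := le_csSup hDbdd ht'D
      linarith
    · exact hft₁ (heq ▸ hin)
  -- `w = f τ` lies in `S' ∩ ℍ ⊆ O`, so in `V` after all
  have hwS' : f τ ∈ S' := closure_minimal hVS' hS' hfτcl
  have hwO : f τ ∈ O := by
    refine ⟨?_, fun hfS ↦ hwS'.2 hfS⟩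
    show 0 < (f τ).im
    rw [hfim]
    have : 0 < z.im := hz.1
    linarith
  have hins : insert (f τ) V ⊆ V := by
    have hpre : IsPreconnected (insert (f τ) V) :=
      isPreconnected_connectedComponentIn.subset_closure (subset_insert _ _)
        (insert_subset hfτcl subset_closure)
    have := hpre.subset_connectedComponentIn (mem_insert_of_mem _ hzV)
      (insert_subset hwO (connectedComponentIn_subset _ _))
    rwa [← hVdef] at this
  exact hfτV (hins (mem_insert _ _))

include hA hSA hS hS' in
/-- **`ℍ ∖ S` is simply connected** for a clopen piece `S` of a `*`-hull (connected, open, with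
connected unbounded complement `S ∪ {Im ≤ 0}`; `Complex.isSimplyConnected_of_compl`). [folklore] -/
theorem isSimplyConnected_diff_piece : IsSimplyConnected (upperHalfPlaneSet \ S) := by
  have hcompl : (upperHalfPlaneSet \ S)ᶜ = S ∪ {z : ℂ | z.im ≤ 0} := by
    ext z
    rw [mem_compl_iff, Set.mem_sdiff, mem_union, not_and, not_not]
    constructor
    · intro h
      by_cases hz : (0 : ℝ) < z.im
      · exact Or.inl (h hz)
      · exact Or.inr (not_lt.1 hz)
    · rintro (h | h)
      · exact fun _ ↦ h
      · exact fun hz ↦ absurd (show (0 : ℝ) < z.im from hz) (not_lt.2 h)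
  refine Complex.isSimplyConnected_of_compl (isOpen_upperHalfPlaneSet.sdiff hS)
    (hA.isConnected_diff_piece hSA hS hS') fun a ha hb ↦ ?_
  rw [hcompl] at ha hb
  have hsub : {z : ℂ | z.im ≤ 0} ⊆ connectedComponentIn (S ∪ {z : ℂ | z.im ≤ 0}) a :=
    subset_union_right.trans ((hA.isConnected_piece_union_im_nonpos hSA hS hS').isPreconnected.subset_connectedComponentIn
      ha subset_rfl)
  obtain ⟨R, hR⟩ := (hb.subset hsub).subset_closedBall 0
  have hmem : (-((|R| + 1 : ℝ) : ℂ) * I) ∈ {z : ℂ | z.im ≤ 0} := by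
    show (-((|R| + 1 : ℝ) : ℂ) * I).im ≤ 0
    simp only [neg_mul, neg_im, mul_im, ofReal_re, I_im, mul_one, ofReal_im, I_re, mul_zero, add_zero]
    linarith [abs_nonneg R]
  have := hR hmem
  rw [mem_closedBall_zero_iff, norm_mul, norm_neg, norm_real, norm_I, mul_one,
    Real.norm_of_nonneg (by positivity)] at this
  linarith [le_abs_self R]

include hA hSA hS hS' in
/-- **A clopen piece of a `*`-hull is a `*`-hull.** For `A ∈ 𝒬*` and `S ⊆ A` with `S` and `A ∖ S`
closed, `S ∈ 𝒬*` (bounded, `S = cl(S ∩ ℍ)`, `ℍ ∖ S` simply connected, `0 ∉ S`); e.g. the part of `A`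
not yet swallowed by a Loewner hull that has swallowed whole clusters of `A`.
[cite: LawlerSchrammWerner2003Restriction, §2 p. 8 (*-hulls 𝒬*)] -/
theorem isStarHull_piece : IsStarHull S :=
  ⟨⟨hA.isBoundedHull.1.subset hSA, hA.closure_piece_inter hSA hS hS',
    hA.isSimplyConnected_diff_piece hSA hS hS'⟩, fun h0 ↦ hA.zero_notMem (hSA h0)⟩

include hA hSA hS hS' in
/-- The complementary piece `A ∖ S` of a clopen piece is a `*`-hull as well. [folklore] -/
theorem isStarHull_diff_piece : IsStarHull (A \ S) :=
  hA.isStarHull_piece sdiff_subset hS' (by rwa [sdiff_sdiff_cancel_left hSA])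

end IsStarHull

end Literature.Probability.RandomPlanarGeometry

end
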